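import Summits.BirchSwinnertonDyer.BirchSwinnertonDyer.Theses.SylvesterTwoHeegnerIndex
import Summits.BirchSwinnertonDyer.BirchSwinnertonDyer.Theorems.SylvesterTwoHeegnerIndexFirstLayerSplit
import Summits.BirchSwinnertonDyer.BirchSwinnertonDyer.Theorems.SylvesterTwoHeegnerIndexCoupledUpperBoundReductionSeven

/-! # Skeleton VARIANT K for crux `UpperOffV0HSYPlus` (stmt-BirchSwinnertonDyer-19804) —
«FIRST LAYER / TAIL SPLIT of the coupled bounds, by residue class» (planner bsd-cm-plan g25, 2026-08-28;
director-bsd g12 gating of record HOME/INBOX.md l.212: rows bsd-cm-k-p1 (FIRST LAYER) / bsd-cm-k-p2 (TAIL)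
are ungated by this registration; VARIANT J `Lines/coupled_variantJ.lean` c020c045f78d3864 stays in the folder
as the coarser reading «crux ⟸ K3 typed ∧ K3* typed»).

WHY.  p590593 `SylvesterTwoFirstLayerSplit.coupledUpperBoundFour_iff_firstLayer_and_tail` proves, granted
`PublishedFactsTwoPlus`, (K3-4) ⟺ FIRST LAYER ∧ TAIL, where FIRST LAYER = the typed conclusion of the cell's
THEOREM K2 (memo two §57: Kolyvagin at level M = 1 for the pair (E_p, E_{3p²}); refereed PASS g59/g60) —
«ord₂(#Ш_an(B)·#Ш_an(A)) = 0 ⇒ Ш(B)[2^∞] = Ш(A)[2^∞] = 0» — and TAIL = (K3-4)'s own conclusion on the pairs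
with 4 < #Ш(B)[2^∞]·#Ш(A)[2^∞] (the induction over levels 2^M with the deep Kolyvagin primes of §64/§65,
refereed g61); on p ≡ 7 (9) the third factor is THEOREM C (crux 19802 `HSYPointTwoDivisibleSevenModNine`),
`coupledUpperBoundSeven_of_thmC_of_firstLayer_of_tail`.  So the crux splits into FIVE registered stubs, each a
genuine piece with its own prover row: firstLayerFour / firstLayerSeven (row k-p1), tailFour / tailSeven (row
k-p2), thmC (= item 19802; desk (M-K3-7) / the 19802 line).  Infrastructure for the provers: LEMMA D series
(`SylvesterTwoUnramified*`), (WRAP-𝒪) p603310 `SylvesterTwoShaOmegaAction`, row bsd-cm-k-ty1 ((WRAP-σ),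
model transport, Kolyvagin classes at 2 in the CM frame).  Nothing is asserted; BSD is not claimed. -/

set_option linter.dupNamespace false

open scoped Classical
open WeierstrassCurve Literature.NumberTheory.EllipticCurves

namespace Summit.BirchSwinnertonDyer.BirchSwinnertonDyer.Cruxes.UpperOffV0HSYPlus.CoupledVariantK

open Summit.BirchSwinnertonDyer.BirchSwinnertonDyer.Theses.SylvesterTwoHeegnerIndex
open Summit.BirchSwinnertonDyer.BirchSwinnertonDyer.Theorems
open Summit.BirchSwinnertonDyer.BirchSwinnertonDyer.Theorems.SylvesterTwoCoupledUpperBound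
open Summit.BirchSwinnertonDyer.BirchSwinnertonDyer.Theorems.SylvesterTwoFirstLayerSplit

/-- **stub (row k-p1, p ≡ 4 (9)) — FIRST LAYER = THEOREM K2 typed**: granted the route's facts, for the HSY
pair (B, A) = (E_p, E_{3p²}), `ord₂(#Ш_an(B)·#Ш_an(A)) = 0 ⇒ #Ш(B)[2^∞] = #Ш(A)[2^∞] = 1`
(Kolyvagin at level `M = 1` for the coupled pair; memo two §57; refereed g59/g60). [size L] -/
theorem stub_firstLayerFour : PublishedFactsTwoPlus →
    ∀ (p : ℕ), p.Prime → p % 9 = 4 → (¬ ∃ x : ZMod p, x ^ 3 = 3) →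
      ∀ (A B : WeierstrassCurve ℚ) [A.IsElliptic] [A.IsGloballyMinimal] [B.IsElliptic]
        [B.IsGloballyMinimal], (∃ C : VariableChange ℚ, C • B = HuShuYin2019.cubeSumCurve (p : ℚ)) →
        (∃ C : VariableChange ℚ, C • A = HuShuYin2019.cubeSumCurve (3 * (p : ℚ) ^ 2)) →
        ∀ (qB qA : ℚ), shaAn B = (qB : ℂ) → shaAn A = (qA : ℂ) → qB * qA ≠ 0 →
          padicValRat 2 (qB * qA) = 0 →
          Nat.card (AddCommGroup.primaryComponent B.sha 2) = 1 ∧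
            Nat.card (AddCommGroup.primaryComponent A.sha 2) = 1 := by
  sorry

/-- **stub (row k-p2, p ≡ 4 (9)) — TAIL**: the coupled bound `s_B + s_A ≤ ord₂(#Ш_an(B)·#Ш_an(A))` on the
pairs with `4 < #Ш(B)[2^∞]·#Ш(A)[2^∞]` (induction over levels `2^M`, deep Kolyvagin primes; memo two
§64/§65, refereed g61). [size L–XL] -/
theorem stub_tailFour : PublishedFactsTwoPlus →
    ∀ (p : ℕ), p.Prime → p % 9 = 4 → (¬ ∃ x : ZMod p, x ^ 3 = 3) →
      ∀ (A B : WeierstrassCurve ℚ) [A.IsElliptic] [A.IsGloballyMinimal] [B.IsElliptic]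
        [B.IsGloballyMinimal], (∃ C : VariableChange ℚ, C • B = HuShuYin2019.cubeSumCurve (p : ℚ)) →
        (∃ C : VariableChange ℚ, C • A = HuShuYin2019.cubeSumCurve (3 * (p : ℚ) ^ 2)) →
        4 < Nat.card (AddCommGroup.primaryComponent B.sha 2) *
            Nat.card (AddCommGroup.primaryComponent A.sha 2) →
        ∃ qB qA : ℚ, shaAn B = (qB : ℂ) ∧ shaAn A = (qA : ℂ) ∧ qB * qA ≠ 0 ∧
          (padicValNat 2 (Nat.card (AddCommGroup.primaryComponent B.sha 2)) : ℤ) +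
              (padicValNat 2 (Nat.card (AddCommGroup.primaryComponent A.sha 2)) : ℤ) ≤
            padicValRat 2 (qB * qA) := by
  sorry

/-- **stub (row k-p1, p ≡ 7 (9)) — FIRST LAYER = COROLLARY K2(7) typed** (memo two §67: under THEOREM C's
(★) the Kolyvagin classes are Kummer at 3 and the `M = 1` argument runs verbatim). [size L] -/
theorem stub_firstLayerSeven : PublishedFactsTwoPlus →
    ∀ (p : ℕ), p.Prime → p % 9 = 7 → (¬ ∃ x : ZMod p, x ^ 3 = 3) →
      ∀ (A B : WeierstrassCurve ℚ) [A.IsElliptic] [A.IsGloballyMinimal] [B.IsElliptic]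
        [B.IsGloballyMinimal], (∃ C : VariableChange ℚ, C • B = HuShuYin2019.cubeSumCurve (p : ℚ)) →
        (∃ C : VariableChange ℚ, C • A = HuShuYin2019.cubeSumCurve (3 * (p : ℚ) ^ 2)) →
        ∀ (qB qA : ℚ), shaAn B = (qB : ℂ) → shaAn A = (qA : ℂ) → qB * qA ≠ 0 →
          padicValRat 2 (qB * qA) = 0 →
          Nat.card (AddCommGroup.primaryComponent B.sha 2) = 1 ∧
            Nat.card (AddCommGroup.primaryComponent A.sha 2) = 1 := by
  sorry

/-- **stub (row k-p2, p ≡ 7 (9)) — TAIL** (THEOREM K3*'s induction on the pairs with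
`4 < #Ш(B)[2^∞]·#Ш(A)[2^∞]`; memo two §67–§68, desk (M-K3-7)). [size L–XL] -/
theorem stub_tailSeven : PublishedFactsTwoPlus →
    ∀ (p : ℕ), p.Prime → p % 9 = 7 → (¬ ∃ x : ZMod p, x ^ 3 = 3) →
      ∀ (A B : WeierstrassCurve ℚ) [A.IsElliptic] [A.IsGloballyMinimal] [B.IsElliptic]
        [B.IsGloballyMinimal], (∃ C : VariableChange ℚ, C • B = HuShuYin2019.cubeSumCurve (p : ℚ)) →
        (∃ C : VariableChange ℚ, C • A = HuShuYin2019.cubeSumCurve (3 * (p : ℚ) ^ 2)) →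
        4 < Nat.card (AddCommGroup.primaryComponent B.sha 2) *
            Nat.card (AddCommGroup.primaryComponent A.sha 2) →
        ∃ qB qA : ℚ, shaAn B = (qB : ℂ) ∧ shaAn A = (qA : ℂ) ∧ qB * qA ≠ 0 ∧
          (padicValNat 2 (Nat.card (AddCommGroup.primaryComponent B.sha 2)) : ℤ) +
              (padicValNat 2 (Nat.card (AddCommGroup.primaryComponent A.sha 2)) : ℤ) ≤
            padicValRat 2 (qB * qA) := by
  sorry

/-- **stub (item 19802) — THEOREM C typed**: `PublishedFactsTwoPlus → HSYPointTwoDivisibleSevenModNine`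
(crux 19802's own skeleton ea25de9eb9afcd52; desk (M-K3-7) bears on its paper form). [size L] -/
theorem stub_thmC : PublishedFactsTwoPlus → SylvesterTwoNonneg.HSYPointTwoDivisibleSevenModNine := by
  sorry

/-- **Composition (kernel-checked)**: the crux BY NAME from the five stubs, through p590593's
`coupledUpperBoundFour_of_firstLayer_of_tail` / `coupledUpperBoundSeven_of_thmC_of_firstLayer_of_tail` and
K3R-7's splice `upperOffV0HSYPlus_of_coupledUpperBounds`. -/
theorem UpperOffV0HSYPlus_of :
    Summit.BirchSwinnertonDyer.BirchSwinnertonDyer.Theses.SylvesterTwoHeegnerIndex.UpperOffV0HSYPlus :=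
  fun hF =>
    upperOffV0HSYPlus_of_coupledUpperBounds
      (coupledUpperBoundFour_of_firstLayer_of_tail hF (stub_firstLayerFour hF) (stub_tailFour hF))
      (coupledUpperBoundSeven_of_thmC_of_firstLayer_of_tail hF (stub_firstLayerSeven hF) (stub_tailSeven hF)
        (stub_thmC hF)) hF

end Summit.BirchSwinnertonDyer.BirchSwinnertonDyer.Cruxes.UpperOffV0HSYPlus.CoupledVariantK
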